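import Mathlib.NumberTheory.LegendreSymbol.JacobiSymbol
import Mathlib.NumberTheory.Multiplicity
import Mathlib.Algebra.Ring.GeomSum
import Mathlib.RingTheory.Int.Basic
import Mathlib.Tactic
import HarnessLib

/-!
# Terjanian's theorem: the first case of Fermat's Last Theorem for even exponents

G. Terjanian, *Sur l'équation `x^{2p} + y^{2p} = z^{2p}`*, C. R. Acad. Sci. Paris 285 (1977),
973–975 [Terjanian1977], as reproduced — statement and proof — in P. Ribenboim, *Fermat's Last
Theorem for Amateurs* (Springer 1999) [Ribenboim1999FLTAmateurs], Chapter VI, §4, (4J)–(4K), with the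
arithmetic of the quotients `Q_n(a,b) = (aⁿ − bⁿ)/(a − b)` from Chapter II, §3, (3.1)–(3.2), (3B).
Everything here is a `theorem` (no named facts).

**Theorem (`Terjanian.terjanian`).** If `p` is an odd prime and `x^{2p} + y^{2p} = z^{2p}` with
`x, y, z ∈ ℤ`, then `2p ∣ x` or `2p ∣ y`. In other words the first case of Fermat's Last Theorem holds
for every exponent `2p`.

## The printed proof and this file

* `Terjanian.Q n a b = Σ_{k<n} a^k b^{n−1−k}`, `Q_n(a,b)(a − b) = aⁿ − bⁿ` (`Q_mul_sub`, Mathlib's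
  `geom_sum₂_mul`); the two reduction formulas of (3B)(1) for `m = nq + r` and `m = nq − r`
  (`Q_mul_add`, `Q_sub_identity`, proved by cancelling `a − b`); (3.2) in the form
  `a − b ∣ Q_n(a,b) − n b^{n−1}` (`sub_dvd_Q_sub`); `gcd(a, Q_n) = gcd(b, Q_n) = 1`
  (`isCoprime_Q_left/right`); positivity for odd `n` (`Q_pos`).
* (4J)(1): `y ≡ z (mod 4)` odd, `m` odd ⇒ `Q_m(z,y) ≡ m (mod 4)` (`Q_mod_four`).
* (4J)(2): for such `y, z` (distinct, coprime) and odd coprime `m, n`, the Jacobi symbol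
  `(Q_m(z,y) / Q_n(z,y)) = (m / n)` (`jacobi_Q`), by the printed Euclidean induction (`jacobi_Q_step`:
  the case `m > n` from the pairs `(r, n)`, `r` the odd one of `m mod n`, `n − (m mod n)`; the case
  `m < n` by quadratic reciprocity on both sides, the signs agreeing because `Q_m ≡ m`, `Q_n ≡ n (mod 4)`).
* `Q_not_sq`: hence `Q_p(z,y)` is not a square for an odd prime `p` — Ribenboim picks a prime `q` with
  `(p/q) = −1`; we pick instead any `q ≡ 1 (mod 4)`, `q ≡ a (mod p)` with `a` a non-residue mod `p`
  (then the Jacobi symbol `(p/q) = (q/p) = (a/p) = −1`), which avoids Dirichlet's theorem — (4J)(2)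
  is stated for all odd coprime `q`, so the printed argument goes through verbatim.
* (4K) (`two_mul_dvd_of_isCoprime`, `terjanian`): reduction to `gcd(x,y) = 1`, `x` even (squares mod 4,
  `not_both_odd`); `x^{2p} = (z² − y²) Q_p(z², y²)` with the gcd of the factors dividing `p`
  (`dvd_of_dvd_sub_of_dvd_Q`, i.e. (3B)(4)); if it is `p` then `p ∣ x`, so `2p ∣ x`; otherwise
  `Q_p(z², y²) = Q_p(z,y) Q_p(z,−y)` is a square with coprime factors, so `Q_p(z, ±y)` is a square for
  the sign with `z ≡ ±y (mod 4)`, contradicting `Q_not_sq`.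

## Search record

`lean search 'Terjanian|x \\^ \\(2 \\* p\\)|geom_sum₂.*jacobi'` — nothing in the tree or Mathlib beyond
`geom_sum₂_mul`, the Jacobi-symbol API (`jacobiSym.quadratic_reciprocity_one_mod_four`,
`jacobiSym.mod_left`, `jacobiSym.sq_one`, `jacobiSym.neg`, `ZMod.χ₄_nat_mod_four`) and
`Int.sq_of_isCoprime`, all used here. presearch: corpus `book:ribenboim1999-fermat-s-last-theorem-amateurs`
pp. 66–67 ((3B)), 156–157 ((4J), (4K)) read; galaxy/corpus searches for "Terjanian" give only
citations of the 1977 note.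
-/

namespace Literature.NumberTheory.DiophantineGeometry

open Finset

namespace Terjanian

/-- `Q n a b = Σ_{k<n} a^k b^{n−1−k} = (aⁿ − bⁿ)/(a − b)` (Ribenboim's `Q_n(a, b)`, Ch. II (3.1)).
[cite: Ribenboim1999FLTAmateurs, Ch. II (3.1)] -/
def Q (n : ℕ) (a b : ℤ) : ℤ := ∑ k ∈ range n, a ^ k * b ^ (n - 1 - k)

/-- `Q_n(a, b)·(a − b) = aⁿ − bⁿ`. [cite: Ribenboim1999FLTAmateurs, Ch. II (3.1)] -/
theorem Q_mul_sub (n : ℕ) (a b : ℤ) : Q n a b * (a - b) = a ^ n - b ^ n := by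
  unfold Q
  exact geom_sum₂_mul a b n

/-- `Q₁ = 1`. [cite: Ribenboim1999FLTAmateurs, Ch. II (3.1)] -/
theorem Q_one (a b : ℤ) : Q 1 a b = 1 := by simp [Q]

/-- **Ribenboim, Ch. II (3B)(1), first identity:** for `m = nq + r`,
`Q_m(a,b) = a^r Q_q(aⁿ, bⁿ) Q_n(a,b) + b^{nq} Q_r(a,b)`. [cite: Ribenboim1999FLTAmateurs, Ch. II (3B)(1)] -/
theorem Q_mul_add (q n r : ℕ) {a b : ℤ} (hab : a ≠ b) :
    Q (q * n + r) a b = a ^ r * Q q (a ^ n) (b ^ n) * Q n a b + b ^ (n * q) * Q r a b := by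
  have h0 : a - b ≠ 0 := sub_ne_zero.mpr hab
  apply mul_right_cancel₀ h0
  have h1 := Q_mul_sub (q * n + r) a b
  have h2 := Q_mul_sub q (a ^ n) (b ^ n)
  have h3 := Q_mul_sub r a b
  have h4 := Q_mul_sub n a b
  have e1 : (a ^ n) ^ q = a ^ (n * q) := by rw [← pow_mul]
  have e2 : (b ^ n) ^ q = b ^ (n * q) := by rw [← pow_mul]
  rw [e1, e2] at h2
  have e3 : a ^ (q * n + r) = a ^ (n * q) * a ^ r := by rw [← pow_add]; ring_nf
  have e4 : b ^ (q * n + r) = b ^ (n * q) * b ^ r := by rw [← pow_add]; ring_nf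
  rw [e3, e4] at h1
  linear_combination h1 - a ^ r * Q q (a ^ n) (b ^ n) * h4 - a ^ r * h2 - b ^ (n * q) * h3

/-- **Ribenboim, Ch. II (3B)(1), second identity** (for `m = nq − r`), in subtraction-free form: with
`n = r + s`, `t = q₂ n + s`, `m = n + t`,
`Q_m = (a^s Q_{q₂+1}(aⁿ, bⁿ) + b^t) Q_n − a^s b^t Q_r`. [cite: Ribenboim1999FLTAmateurs, Ch. II (3B)(1)] -/
theorem Q_sub_identity (q₂ r s : ℕ) {a b : ℤ} (hab : a ≠ b) :
    Q (r + s + (q₂ * (r + s) + s)) a b =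
      (a ^ s * Q (q₂ + 1) (a ^ (r + s)) (b ^ (r + s)) + b ^ (q₂ * (r + s) + s)) * Q (r + s) a b
        - a ^ s * b ^ (q₂ * (r + s) + s) * Q r a b := by
  have h0 : a - b ≠ 0 := sub_ne_zero.mpr hab
  apply mul_right_cancel₀ h0
  have h1 := Q_mul_sub (r + s + (q₂ * (r + s) + s)) a b
  have h2 := Q_mul_sub (q₂ + 1) (a ^ (r + s)) (b ^ (r + s))
  have h3 := Q_mul_sub r a b
  have h4 := Q_mul_sub (r + s) a b
  have e1 : (a ^ (r + s)) ^ (q₂ + 1) = a ^ (q₂ * (r + s) + s) * a ^ r := by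
    rw [← pow_mul, ← pow_add]; ring_nf
  have e2 : (b ^ (r + s)) ^ (q₂ + 1) = b ^ (q₂ * (r + s) + s) * b ^ r := by
    rw [← pow_mul, ← pow_add]; ring_nf
  rw [e1, e2] at h2
  have e3 : a ^ (r + s + (q₂ * (r + s) + s)) = a ^ (q₂ * (r + s) + s) * a ^ r * a ^ s := by
    rw [← pow_add, ← pow_add]; ring_nf
  have e4 : b ^ (r + s + (q₂ * (r + s) + s)) = b ^ (q₂ * (r + s) + s) * b ^ r * b ^ s := by
    rw [← pow_add, ← pow_add]; ring_nf
  have e5 : a ^ (r + s) = a ^ r * a ^ s := pow_add _ _ _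
  have e6 : b ^ (r + s) = b ^ r * b ^ s := pow_add _ _ _
  rw [e3, e4] at h1
  rw [e5, e6] at h4
  linear_combination h1 - (a ^ s * Q (q₂ + 1) (a ^ (r + s)) (b ^ (r + s)) + b ^ (q₂ * (r + s) + s)) * h4
    - a ^ s * h2 + a ^ s * b ^ (q₂ * (r + s) + s) * h3

/-- `(a − b) ∣ Q_n(a,b) − n b^{n−1}` (Ribenboim (3.2): `Q_n(a,b) = (a − b)e + n b^{n−1}`).
[cite: Ribenboim1999FLTAmateurs, Ch. II (3.2)] -/
theorem sub_dvd_Q_sub (n : ℕ) {a b : ℤ} (hab : a ≠ b) : a - b ∣ Q n a b - n * b ^ (n - 1) := by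
  have h0 : a - b ≠ 0 := sub_ne_zero.mpr hab
  have h2 := sq_dvd_add_pow_sub_sub (a - b) b n
  have e1 : b + (a - b) = a := by ring
  rw [e1] at h2
  have e : a ^ n - b ^ (n - 1) * (a - b) * n - b ^ n = (Q n a b - n * b ^ (n - 1)) * (a - b) := by
    have := Q_mul_sub n a b
    linear_combination -this
  rw [e, pow_two] at h2
  exact (mul_dvd_mul_iff_right h0).mp h2

/-- `Q_n(a,b)·(a − b) + bⁿ = aⁿ`: so a prime dividing `b` and `Q_n(a,b)` divides `a`; with
`gcd(a,b) = 1` (and `n ≥ 1`), `gcd(b, Q_n(a,b)) = 1`. [cite: Ribenboim1999FLTAmateurs, Ch. II (3B)(2) (proof)] -/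
theorem isCoprime_Q_right {n : ℕ} (hn : n ≠ 0) {a b : ℤ} (hab : IsCoprime a b) :
    IsCoprime b (Q n a b) := by
  rw [Int.isCoprime_iff_gcd_eq_one]
  by_contra hg
  obtain ⟨r, hr, hrg⟩ := Nat.exists_prime_and_dvd hg
  have hrb : (r : ℤ) ∣ b := (Int.natCast_dvd_natCast.mpr hrg).trans (Int.gcd_dvd_left ..)
  have hrQ : (r : ℤ) ∣ Q n a b := (Int.natCast_dvd_natCast.mpr hrg).trans (Int.gcd_dvd_right ..)
  have hr' : Prime (r : ℤ) := Nat.prime_iff_prime_int.mp hr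
  have hra : (r : ℤ) ∣ a ^ n := by
    have e : a ^ n = Q n a b * (a - b) + b ^ n := by rw [Q_mul_sub]; ring
    rw [e]
    exact dvd_add (dvd_mul_of_dvd_left hrQ _) (dvd_pow hrb hn)
  exact hr'.not_unit (hab.symm.isUnit_of_dvd' hrb (hr'.dvd_of_dvd_pow hra))

/-- `Q_n` is symmetric: `Q_n(a,b) = Q_n(b,a)`. [cite: Ribenboim1999FLTAmateurs, Ch. II (3.1)] -/
theorem Q_comm (n : ℕ) (a b : ℤ) : Q n a b = Q n b a := by
  by_cases hab : a = b
  · rw [hab]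
  · apply mul_right_cancel₀ (sub_ne_zero.mpr hab)
    have h1 := Q_mul_sub n a b
    have h2 := Q_mul_sub n b a
    linear_combination h1 + h2

/-- Symmetrically `gcd(a, Q_n(a,b)) = 1`. [cite: Ribenboim1999FLTAmateurs, Ch. II (3B)(2) (proof)] -/
theorem isCoprime_Q_left {n : ℕ} (hn : n ≠ 0) {a b : ℤ} (hab : IsCoprime a b) :
    IsCoprime a (Q n a b) := by
  rw [Q_comm]
  exact isCoprime_Q_right hn hab.symm

/-- For odd `n` and `a ≠ b`, `Q_n(a,b) > 0` (`aⁿ − bⁿ` and `a − b` have the same sign).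
[cite: Ribenboim1999FLTAmateurs, Ch. VI (4J) (proof: "Q_n(z,y) > 0")] -/
theorem Q_pos {n : ℕ} (hn : Odd n) {a b : ℤ} (hab : a ≠ b) : 0 < Q n a b := by
  have h := Q_mul_sub n a b
  have hmono := Odd.strictMono_pow (R := ℤ) hn
  rcases lt_or_gt_of_ne hab with hlt | hgt
  · have h1 : a ^ n < b ^ n := hmono hlt
    nlinarith
  · have h1 : b ^ n < a ^ n := hmono hgt
    nlinarith

/-- **Ribenboim, (4J)(1):** for odd `y, z` with `y ≡ z (mod 4)`, `y ≠ z`, and odd `m`,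
`Q_m(z, y) ≡ m (mod 4)`; in particular `Q_m(z, y)` is odd. [cite: Ribenboim1999FLTAmateurs, Ch. VI (4J)(1)] -/
theorem Q_mod_four {m : ℕ} (hm : Odd m) {y z : ℤ} (hy : Odd y) (hyz : (4 : ℤ) ∣ z - y) (hne : z ≠ y) :
    (4 : ℤ) ∣ Q m z y - m := by
  have h1 : (4 : ℤ) ∣ Q m z y - m * y ^ (m - 1) := hyz.trans (sub_dvd_Q_sub m hne)
  -- `y^{m-1} = (y²)^{(m-1)/2} ≡ 1 (mod 4)` hence `m y^{m-1} ≡ m`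
  have h2 : (4 : ℤ) ∣ y ^ (m - 1) - 1 := by
    obtain ⟨k, hk⟩ := hm
    obtain ⟨j, rfl⟩ := hy
    have e : (2 * j + 1 : ℤ) ^ (m - 1) = ((2 * j + 1) ^ 2) ^ k := by
      rw [← pow_mul]; congr 1; omega
    rw [e]
    have h8 : (4 : ℤ) ∣ (2 * j + 1) ^ 2 - 1 := ⟨j ^ 2 + j, by ring⟩
    exact h8.trans (by simpa using sub_dvd_pow_sub_pow ((2 * j + 1 : ℤ) ^ 2) 1 k)
  have e : Q m z y - m = (Q m z y - m * y ^ (m - 1)) + m * (y ^ (m - 1) - 1) := by ring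
  rw [e]
  exact dvd_add h1 (dvd_mul_of_dvd_right h2 _)

/-! ## (4J)(2): the Jacobi symbol `(Q_m(z,y) / Q_n(z,y)) = (m / n)` -/

open scoped NumberTheorySymbols

section Jacobi

variable {y z : ℤ}

/-- `Q_n(z,y)` (odd `n`, `z ≠ y`) as a natural number casts back to itself.
[cite: Ribenboim1999FLTAmateurs, Ch. VI (4J)(1)] -/
theorem natAbs_Q_cast {n : ℕ} (hn : Odd n) (hne : z ≠ y) :
    (((Q n z y).natAbs : ℕ) : ℤ) = Q n z y :=
  Int.natAbs_of_nonneg (Q_pos hn hne).le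

/-- `Q_n(z,y) mod 4 = n mod 4` as natural numbers. [cite: Ribenboim1999FLTAmateurs, Ch. VI (4J)(1)] -/
theorem natAbs_Q_mod_four {n : ℕ} (hn : Odd n) (hy : Odd y) (hyz : (4 : ℤ) ∣ z - y)
    (hne : z ≠ y) : (Q n z y).natAbs % 4 = n % 4 := by
  have h1 := Q_mod_four hn hy hyz hne
  have h2 := Q_pos hn hne
  omega

/-- `Q_n(z,y)` is odd (as a natural number). [cite: Ribenboim1999FLTAmateurs, Ch. VI (4J)(1)] -/
theorem natAbs_Q_odd {n : ℕ} (hn : Odd n) (hy : Odd y) (hyz : (4 : ℤ) ∣ z - y) (hne : z ≠ y) :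
    Odd (Q n z y).natAbs := by
  have h := natAbs_Q_mod_four hn hy hyz hne
  rw [Nat.odd_iff]
  obtain ⟨k, hk⟩ := hn
  omega

/-- `gcd(a, Q_n(z,y)) = 1` in the form the Jacobi-symbol API wants.
[cite: Ribenboim1999FLTAmateurs, Ch. VI (4J)(2) (proof)] -/
theorem gcd_natAbs_Q_eq_one {n : ℕ} {a : ℤ} (h : IsCoprime a (Q n z y)) :
    a.gcd ((Q n z y).natAbs : ℤ) = 1 := by
  have h1 := Int.isCoprime_iff_gcd_eq_one.mp h
  rw [Int.gcd_eq_natAbs, Int.natAbs_natCast, ← Int.gcd_eq_natAbs]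
  exact h1

/-- An even power of `J(a | Q_n)` is `1` when `gcd(a, Q_n) = 1`.
[cite: Ribenboim1999FLTAmateurs, Ch. VI (4J)(2) (proof)] -/
theorem jacobi_pow_even {n : ℕ} {a : ℤ} (h : IsCoprime a (Q n z y)) {e : ℕ} (he : Even e) :
    J(a | (Q n z y).natAbs) ^ e = 1 := by
  obtain ⟨k, rfl⟩ := he
  rw [← two_mul, pow_mul, jacobiSym.sq_one (gcd_natAbs_Q_eq_one h), one_pow]

/-- The Euclidean step of (4J)(2): for `m > n`, the identity for `(m, n)` follows from the
identities for pairs with smaller sum (via the two reduction formulas (3B)(1)).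
[cite: Ribenboim1999FLTAmateurs, Ch. VI (4J)(2) (proof)] -/
theorem jacobi_Q_step (hy : Odd y) (hyz : (4 : ℤ) ∣ z - y) (hne : z ≠ y) (hcop : IsCoprime z y)
    {m n : ℕ} (hm : Odd m) (hn : Odd n) (hmn : Nat.Coprime m n) (hlt : n < m)
    (IH : ∀ m' n' : ℕ, m' + n' < m + n → Odd m' → Odd n' → Nat.Coprime m' n' →
      J(Q m' z y | (Q n' z y).natAbs) = J((m' : ℤ) | n')) :
    J(Q m z y | (Q n z y).natAbs) = J((m : ℤ) | n) := by
  have hQn := natAbs_Q_cast hn hne (z := z) (y := y)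
  by_cases hn1 : n = 1
  · subst hn1
    simp [Q_one, jacobiSym.one_right]
  -- division with remainder: `m = q n + r₀`, `0 < r₀ < n`
  set q := m / n with hq
  set r₀ := m % n with hr₀
  have hdiv : n * q + r₀ = m := Nat.div_add_mod m n
  have hnpos : 0 < n := hn.pos
  have hr₀lt : r₀ < n := Nat.mod_lt _ hnpos
  have hr₀0 : r₀ ≠ 0 := by
    intro h0
    have : n ∣ m := Nat.dvd_of_mod_eq_zero (by rw [← hr₀, h0])
    have : Nat.gcd m n = n := Nat.gcd_eq_right this
    rw [hmn] at this
    exact hn1 this.symm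
  have hq1 : 1 ≤ q := by rw [hq]; exact Nat.div_pos hlt.le hnpos
  have hcopr : Nat.Coprime r₀ n := by
    unfold Nat.Coprime
    rw [hr₀, ← Nat.gcd_rec, Nat.gcd_comm]
    exact hmn
  rcases Nat.even_or_odd r₀ with hr₀e | hr₀o
  · -- `r₀` even: use `m = (q₂+1) n + s`, `s = r₀`, `r = n - s` odd, second identity
    obtain ⟨r, hr⟩ : ∃ r, n = r + r₀ := ⟨n - r₀, by omega⟩
    have hro : Odd r := by
      rcases Nat.even_or_odd r with h | h
      · exfalso
        rw [hr] at hn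
        exact Nat.not_even_iff_odd.mpr hn (h.add hr₀e)
      · exact h
    obtain ⟨q₂, hq₂⟩ : ∃ q₂, q = q₂ + 1 := ⟨q - 1, by omega⟩
    have hm_eq : m = n + (q₂ * n + r₀) := by
      rw [← hdiv, hq₂]; ring
    have hid := Q_sub_identity q₂ r r₀ hne
    rw [← hr, ← hm_eq] at hid
    -- `Q_m ≡ - z^s y^t Q_r (mod Q_n)`
    set t := q₂ * n + r₀ with ht
    have hte : Even t := by
      have : t + n = m := by omega
      rcases Nat.even_or_odd t with h | h
      · exact h
      · exfalso
        have : Even m := by rw [← this]; exact h.add_odd hn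
        exact Nat.not_even_iff_odd.mpr hm this
    have hmod : Q m z y % ((Q n z y).natAbs : ℤ) =
        (-(z ^ r₀ * y ^ t * Q r z y)) % ((Q n z y).natAbs : ℤ) := by
      rw [hQn, hid]
      have e : (z ^ r₀ * Q (q₂ + 1) (z ^ n) (y ^ n) + y ^ t) * Q n z y - z ^ r₀ * y ^ t * Q r z y
          = -(z ^ r₀ * y ^ t * Q r z y)
            + Q n z y * (z ^ r₀ * Q (q₂ + 1) (z ^ n) (y ^ n) + y ^ t) := by ring
      rw [e, Int.add_mul_emod_self_left]
    rw [jacobiSym.mod_left' hmod, jacobiSym.neg _ (natAbs_Q_odd hn hy hyz hne),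
      jacobiSym.mul_left, jacobiSym.mul_left, jacobiSym.pow_left, jacobiSym.pow_left,
      jacobi_pow_even (isCoprime_Q_left hn.pos.ne' hcop) hr₀e,
      jacobi_pow_even (isCoprime_Q_right hn.pos.ne' hcop) hte, one_mul, one_mul]
    -- `χ₄(Q_n) = χ₄(n)` and the induction hypothesis for `(r, n)`
    have hχ : ZMod.χ₄ ((Q n z y).natAbs : ℕ) = ZMod.χ₄ (n : ℕ) := by
      rw [ZMod.χ₄_nat_mod_four, natAbs_Q_mod_four hn hy hyz hne, ← ZMod.χ₄_nat_mod_four]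
    have hrn : Nat.Coprime r n := by
      refine Nat.eq_one_of_dvd_coprimes hcopr ?_ (Nat.gcd_dvd_right r n)
      have := Nat.dvd_sub (Nat.gcd_dvd_right r n) (Nat.gcd_dvd_left r n)
      rwa [show n - r = r₀ by omega] at this
    have hIH := IH r n (by omega) hro hn hrn
    rw [hIH, hχ, ← jacobiSym.at_neg_one hn, ← jacobiSym.mul_left]
    -- `m ≡ -r (mod n)`
    refine jacobiSym.mod_left' ?_
    have e : (m : ℤ) = -1 * r + n * (q₂ + 2) := by
      have e1 : (m : ℤ) = n + (q₂ * n + r₀) := by exact_mod_cast hm_eq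
      have e2 : (n : ℤ) = r + r₀ := by exact_mod_cast hr
      linear_combination e1 - e2
    rw [e, Int.add_mul_emod_self_left]
  · -- `r₀` odd: first identity, `Q_m ≡ y^{nq} Q_{r₀} (mod Q_n)`
    have hid := Q_mul_add q n r₀ hne
    have hm_eq : q * n + r₀ = m := by rw [← hdiv]; ring
    rw [hm_eq] at hid
    have hnqe : Even (n * q) := by
      rcases Nat.even_or_odd (n * q) with h | h
      · exact h
      · exfalso
        have : Even m := by rw [← hdiv]; exact h.add_odd hr₀o
        exact Nat.not_even_iff_odd.mpr hm this
    have hmod : Q m z y % ((Q n z y).natAbs : ℤ) =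
        (y ^ (n * q) * Q r₀ z y) % ((Q n z y).natAbs : ℤ) := by
      rw [hQn, hid]
      have e : z ^ r₀ * Q q (z ^ n) (y ^ n) * Q n z y + y ^ (n * q) * Q r₀ z y
          = y ^ (n * q) * Q r₀ z y + Q n z y * (z ^ r₀ * Q q (z ^ n) (y ^ n)) := by ring
      rw [e, Int.add_mul_emod_self_left]
    rw [jacobiSym.mod_left' hmod, jacobiSym.mul_left, jacobiSym.pow_left,
      jacobi_pow_even (isCoprime_Q_right hn.pos.ne' hcop) hnqe, one_mul]
    have hIH := IH r₀ n (by omega) hr₀o hn hcopr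
    rw [hIH]
    refine jacobiSym.mod_left' ?_
    have e : (m : ℤ) = r₀ + n * q := by rw [← hdiv]; push_cast; ring
    rw [e, Int.add_mul_emod_self_left]

end Jacobi

/-- **Ribenboim, Ch. VI (4J)(2)** (Terjanian's lemma). Let `y, z` be distinct coprime odd integers with
`y ≡ z (mod 4)`. For odd coprime `m, n ≥ 1` the Jacobi symbol `(Q_m(z,y) / Q_n(z,y))` equals `(m / n)`.
Proof as printed: Euclidean induction on `m + n` using the two reduction formulas (3B)(1), the
congruence `Q_n ≡ n (mod 4)` of (4J)(1), and quadratic reciprocity for the Jacobi symbol.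
[cite: Ribenboim1999FLTAmateurs, Ch. VI (4J)(2)] -/
theorem jacobi_Q {y z : ℤ} (hy : Odd y) (hyz : (4 : ℤ) ∣ z - y) (hne : z ≠ y) (hcop : IsCoprime z y)
    {m n : ℕ} (hm : Odd m) (hn : Odd n) (hmn : Nat.Coprime m n) :
    J(Q m z y | (Q n z y).natAbs) = J((m : ℤ) | n) := by
  suffices H : ∀ k m n, m + n = k → Odd m → Odd n → Nat.Coprime m n →
      J(Q m z y | (Q n z y).natAbs) = J((m : ℤ) | n) from H _ m n rfl hm hn hmn
  intro k
  induction k using Nat.strong_induction_on with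
  | _ k IHk => ?_
  intro m n hk hm hn hmn
  have IH : ∀ m' n' : ℕ, m' + n' < m + n → Odd m' → Odd n' → Nat.Coprime m' n' →
      J(Q m' z y | (Q n' z y).natAbs) = J((m' : ℤ) | n') :=
    fun m' n' hlt hm' hn' hc => IHk (m' + n') (hk ▸ hlt) m' n' rfl hm' hn' hc
  rcases lt_trichotomy n m with hlt | heq | hgt
  · exact jacobi_Q_step hy hyz hne hcop hm hn hmn hlt IH
  · subst heq
    have hn1 : n = 1 := by
      have := hmn
      unfold Nat.Coprime at this
      rwa [Nat.gcd_self] at this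
    subst hn1
    simp [Q_one]
  · have hstep := jacobi_Q_step hy hyz hne hcop hn hm hmn.symm hgt
      (fun m' n' hlt hm' hn' hc => IH m' n' (by omega) hm' hn' hc)
    have ha := natAbs_Q_cast hm hne (z := z) (y := y)
    have hb := natAbs_Q_cast hn hne (z := z) (y := y)
    have ha4 := natAbs_Q_mod_four hm hy hyz hne (z := z)
    have hb4 := natAbs_Q_mod_four hn hy hyz hne (z := z)
    have hao := natAbs_Q_odd hm hy hyz hne (z := z)
    have hbo := natAbs_Q_odd hn hy hyz hne (z := z)
    rw [← ha]
    rw [← hb] at hstep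
    have hm4 : m % 4 = 1 ∨ m % 4 = 3 := by obtain ⟨k, rfl⟩ := hm; omega
    have hn4 : n % 4 = 1 ∨ n % 4 = 3 := by obtain ⟨k, rfl⟩ := hn; omega
    rcases hm4 with hm1 | hm3
    · rw [jacobiSym.quadratic_reciprocity_one_mod_four (by omega : (Q m z y).natAbs % 4 = 1) hbo,
        hstep, jacobiSym.quadratic_reciprocity_one_mod_four hm1 hn]
    · rcases hn4 with hn1 | hn3
      · rw [jacobiSym.quadratic_reciprocity_one_mod_four' hao (by omega : (Q n z y).natAbs % 4 = 1),
          hstep, jacobiSym.quadratic_reciprocity_one_mod_four' hm hn1]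
      · rw [jacobiSym.quadratic_reciprocity_three_mod_four (by omega : (Q m z y).natAbs % 4 = 3)
            (by omega : (Q n z y).natAbs % 4 = 3),
          hstep, jacobiSym.quadratic_reciprocity_three_mod_four hm3 hn3]

/-- Consequently, under the hypotheses of (4J), `Q_p(z,y)` is **not a square** for an odd prime `p`:
choose `a` a quadratic non-residue mod `p` and `q ≡ a (mod p)`, `q ≡ 1 (mod 4)`; then
`(Q_p / Q_q) = (p / q) = (q / p) = (a / p) = −1`. (Ribenboim takes `q` prime with `(p/q) = −1`; any odd
`q` coprime to `p` with Jacobi symbol `(p/q) = −1` serves, which avoids Dirichlet's theorem.)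
[cite: Ribenboim1999FLTAmateurs, Ch. VI (4K) (proof, last paragraph)] -/
theorem Q_not_sq {y z : ℤ} (hy : Odd y) (hyz : (4 : ℤ) ∣ z - y) (hne : z ≠ y) (hcop : IsCoprime z y)
    {p : ℕ} (hp : p.Prime) (hp2 : p ≠ 2) (d : ℤ) : Q p z y ≠ d ^ 2 := by
  haveI := Fact.mk hp
  have hpodd : Odd p := hp.odd_of_ne_two hp2
  -- a quadratic non-residue `a` mod `p`, `1 ≤ a ≤ p - 1`
  obtain ⟨a0, ha0⟩ := FiniteField.exists_nonsquare (F := ZMod p)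
    (by rw [ZMod.ringChar_zmod_n]; exact hp2)
  have ha0ne : a0 ≠ 0 := by rintro rfl; exact ha0 ⟨0, by simp⟩
  set a : ℕ := a0.val with ha
  have ha1 : 1 ≤ a := Nat.one_le_iff_ne_zero.mpr ((ZMod.val_ne_zero a0).mpr ha0ne)
  have hap : a < p := ZMod.val_lt a0
  have hJa : J((a : ℤ) | p) = -1 := by
    rw [← jacobiSym.legendreSym.to_jacobiSym, legendreSym.eq_neg_one_iff]
    have : ((a : ℤ) : ZMod p) = a0 := by simp [ha]
    rwa [this]
  -- `q = a + j p ≡ 1 (mod 4)` for a suitable `j ∈ {0,1,2,3}`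
  obtain ⟨j, hj⟩ : ∃ j : ℕ, (a + j * p) % 4 = 1 := by
    have hp4 : p % 4 = 1 ∨ p % 4 = 3 := by obtain ⟨k, hk⟩ := hpodd; omega
    have ha4 : a % 4 = 0 ∨ a % 4 = 1 ∨ a % 4 = 2 ∨ a % 4 = 3 := by omega
    rcases hp4 with h4 | h4 <;> rcases ha4 with h | h | h | h
    exacts [⟨1, by omega⟩, ⟨0, by omega⟩, ⟨3, by omega⟩, ⟨2, by omega⟩, ⟨3, by omega⟩, ⟨0, by omega⟩,
      ⟨1, by omega⟩, ⟨2, by omega⟩]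
  set q : ℕ := a + j * p with hq
  have hqodd : Odd q := Nat.odd_iff.mpr (by omega)
  have hpq : Nat.Coprime p q := by
    rw [hq, Nat.coprime_add_mul_right_right]
    exact (Nat.Prime.coprime_iff_not_dvd hp).mpr fun h => by
      have := Nat.le_of_dvd (by omega) h
      omega
  intro hQ
  have hJ := jacobi_Q hy hyz hne hcop hpodd hqodd hpq
  have hJpq : J((p : ℤ) | q) = -1 := by
    rw [jacobiSym.quadratic_reciprocity_one_mod_four' hpodd hj, jacobiSym.mod_left (q : ℤ) p]
    have e : (q : ℤ) % p = a := by
      rw [hq]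
      push_cast
      rw [Int.add_mul_emod_self_right]
      exact Int.emod_eq_of_lt (by positivity) (by exact_mod_cast hap)
    rw [e]
    exact hJa
  rw [hQ, jacobiSym.pow_left, hJpq] at hJ
  nlinarith [sq_nonneg (J(d | (Q q z y).natAbs))]

/-! ## (4K): Terjanian's theorem -/

/-- **(3B)(4) in the form needed:** a common divisor of `a − b` and `Q_p(a,b)` divides `p`
(when `gcd(a,b) = 1`), because `Q_p(a,b) ≡ p b^{p−1} (mod a − b)`.
[cite: Ribenboim1999FLTAmateurs, Ch. II (3B)(4)] -/
theorem dvd_of_dvd_sub_of_dvd_Q {p : ℕ} {a b g : ℤ} (hab : IsCoprime a b) (hne : a ≠ b)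
    (h1 : g ∣ a - b) (h2 : g ∣ Q p a b) : g ∣ (p : ℤ) := by
  have h3 : g ∣ (p : ℤ) * b ^ (p - 1) := by
    have h4 := h1.trans (sub_dvd_Q_sub p hne)
    have e : (p : ℤ) * b ^ (p - 1) = Q p a b - (Q p a b - p * b ^ (p - 1)) := by ring
    rw [e]
    exact dvd_sub h2 h4
  have hcop : IsCoprime g (b ^ (p - 1)) := by
    have h5 : IsCoprime (a - b) b := by
      have e : a - b = a + b * (-1) := by ring
      rw [e]
      exact hab.add_mul_left_left (-1)
    exact (h5.of_isCoprime_of_dvd_left h1).pow_right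
  exact hcop.dvd_of_dvd_mul_right h3

/-- Odd squares are `1 (mod 4)`. [folklore] -/
private theorem sq_mod_four_of_odd {w : ℤ} (hw : Odd w) : w ^ 2 % 4 = 1 := by
  obtain ⟨k, rfl⟩ := hw
  have e : (2 * k + 1) ^ 2 = 4 * (k ^ 2 + k) + 1 := by ring
  omega

/-- Even squares are `0 (mod 4)`. [folklore] -/
private theorem sq_mod_four_of_even {w : ℤ} (hw : Even w) : w ^ 2 % 4 = 0 := by
  obtain ⟨k, rfl⟩ := hw
  have e : (k + k) ^ 2 = 4 * k ^ 2 := by ring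
  omega

/-- Not both of `x, y` are odd in `x^{2p} + y^{2p} = z^{2p}`: squares are `0, 1 (mod 4)`.
[cite: Ribenboim1999FLTAmateurs, Ch. VI (4K) (proof, first lines)] -/
theorem not_both_odd {p : ℕ} {x y z : ℤ} (h : x ^ (2 * p) + y ^ (2 * p) = z ^ (2 * p))
    (hx : Odd x) (hy : Odd y) : False := by
  have ex : x ^ (2 * p) = (x ^ p) ^ 2 := by rw [← pow_mul, mul_comm]
  have ey : y ^ (2 * p) = (y ^ p) ^ 2 := by rw [← pow_mul, mul_comm]
  have ez : z ^ (2 * p) = (z ^ p) ^ 2 := by rw [← pow_mul, mul_comm]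
  rw [ex, ey, ez] at h
  have h1 := sq_mod_four_of_odd (hx.pow (n := p))
  have h2 := sq_mod_four_of_odd (hy.pow (n := p))
  rcases Int.even_or_odd (z ^ p) with he | ho
  · have h3 := sq_mod_four_of_even he
    omega
  · have h3 := sq_mod_four_of_odd ho
    omega

/-- **Terjanian's theorem, coprime normal form.** If `p` is an odd prime, `gcd(x, y) = 1`, `x` is even
and `x^{2p} + y^{2p} = z^{2p}`, then `2p ∣ x`. Proof as printed (Ribenboim (4K)): with `x ≠ 0`,
`x^{2p} = (z² − y²)·Q_p(z², y²)`, the gcd of the two factors divides `p`; if it is `p` then `p ∣ x`;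
otherwise both factors are squares, `Q_p(z², y²) = Q_p(z, y) Q_p(z, −y)` with coprime (odd) factors, so
`Q_p(z, ±y)` is a square for the sign with `z ≡ ±y (mod 4)` — contradicting (4J).
[cite: Ribenboim1999FLTAmateurs, Ch. VI (4K)] -/
theorem two_mul_dvd_of_isCoprime {p : ℕ} (hp : p.Prime) (hp2 : p ≠ 2) {x y z : ℤ}
    (hxy : IsCoprime x y) (hx2 : 2 ∣ x) (h : x ^ (2 * p) + y ^ (2 * p) = z ^ (2 * p)) :
    2 * (p : ℤ) ∣ x := by
  by_cases hx0 : x = 0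
  · simp [hx0]
  have hpodd : Odd p := hp.odd_of_ne_two hp2
  have hp' : Prime (p : ℤ) := Nat.prime_iff_prime_int.mp hp
  have h2p0 : 2 * p ≠ 0 := by have := hp.pos; omega
  -- `y` odd, `z` odd, `gcd(z, y) = 1`
  have hy : Odd y := by
    rcases Int.even_or_odd y with he | ho
    · exfalso
      have hu : IsUnit (2 : ℤ) := hxy.isUnit_of_dvd' hx2 (even_iff_two_dvd.mp he)
      norm_num [Int.isUnit_iff] at hu
    · exact ho
  have hz : Odd z := by
    have h1 : Odd (z ^ (2 * p)) := by
      rw [← h]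
      exact Even.add_odd ((Int.even_pow).mpr ⟨even_iff_two_dvd.mpr hx2, h2p0⟩) (hy.pow)
    exact (Int.odd_pow.mp h1).resolve_right h2p0
  have hzy : IsCoprime z y := by
    rw [Int.isCoprime_iff_gcd_eq_one]
    by_contra hg
    obtain ⟨r, hr, hrg⟩ := Nat.exists_prime_and_dvd hg
    have hrz : (r : ℤ) ∣ z := (Int.natCast_dvd_natCast.mpr hrg).trans (Int.gcd_dvd_left ..)
    have hry : (r : ℤ) ∣ y := (Int.natCast_dvd_natCast.mpr hrg).trans (Int.gcd_dvd_right ..)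
    have hr' : Prime (r : ℤ) := Nat.prime_iff_prime_int.mp hr
    have hrx : (r : ℤ) ∣ x ^ (2 * p) := by
      have e : x ^ (2 * p) = z ^ (2 * p) - y ^ (2 * p) := by linear_combination h
      rw [e]
      exact dvd_sub (dvd_pow hrz h2p0) (dvd_pow hry h2p0)
    exact hr'.not_unit (hxy.isUnit_of_dvd' (hr'.dvd_of_dvd_pow hrx) hry)
  have hzy2 : IsCoprime (z ^ 2) (y ^ 2) := hzy.pow
  -- `z² > y²`
  have hlt : y ^ 2 < z ^ 2 := by
    by_contra hle
    rw [not_lt] at hle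
    have h1 : (z ^ 2) ^ p ≤ (y ^ 2) ^ p := pow_le_pow_left₀ (sq_nonneg z) hle p
    have h2 : 0 < x ^ (2 * p) := by
      have e : x ^ (2 * p) = (x ^ p) ^ 2 := by rw [← pow_mul, mul_comm]
      have hxp : x ^ p ≠ 0 := pow_ne_zero p hx0
      rw [e]
      positivity
    rw [← pow_mul, ← pow_mul] at h1
    linarith
  have hne2 : z ^ 2 ≠ y ^ 2 := hlt.ne'
  -- the factorisation `x^{2p} = (z² − y²) Q_p(z², y²)`
  have hfac : Q p (z ^ 2) (y ^ 2) * (z ^ 2 - y ^ 2) = (x ^ p) ^ 2 := by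
    have e1 : (z ^ 2) ^ p = z ^ (2 * p) := by rw [← pow_mul]
    have e2 : (y ^ 2) ^ p = y ^ (2 * p) := by rw [← pow_mul]
    have e3 : (x ^ p) ^ 2 = x ^ (2 * p) := by rw [← pow_mul, mul_comm]
    rw [Q_mul_sub, e1, e2, e3]
    linear_combination -h
  by_cases hAB : IsCoprime (Q p (z ^ 2) (y ^ 2)) (z ^ 2 - y ^ 2)
  · exfalso
    -- both factors are squares; `B = Q_p(z², y²) = c²`
    obtain ⟨c, hc⟩ := Int.sq_of_isCoprime hAB hfac
    have hBpos : 0 < Q p (z ^ 2) (y ^ 2) := Q_pos hpodd hne2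
    have hB : Q p (z ^ 2) (y ^ 2) = c ^ 2 := by
      rcases hc with hc | hc
      · exact hc
      · nlinarith [sq_nonneg c]
    -- `B = Q_p(z,y) Q_p(z,-y)`
    have hBfac : Q p (z ^ 2) (y ^ 2) = Q p z y * Q p z (-y) := by
      apply mul_right_cancel₀ (sub_ne_zero.mpr hne2)
      have h1 := Q_mul_sub p (z ^ 2) (y ^ 2)
      have h2 := Q_mul_sub p z y
      have h3 := Q_mul_sub p z (-y)
      rw [Odd.neg_pow hpodd, sub_neg_eq_add, sub_neg_eq_add] at h3
      have e1 : (z ^ 2) ^ p = (z ^ p) ^ 2 := by rw [← pow_mul, ← pow_mul, mul_comm]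
      have e2 : (y ^ 2) ^ p = (y ^ p) ^ 2 := by rw [← pow_mul, ← pow_mul, mul_comm]
      rw [e1, e2] at h1
      linear_combination h1 - (Q p z (-y) * (z + y)) * h2 - (z ^ p - y ^ p) * h3
    -- `B` is odd (it is coprime to the even number `z² − y²`)
    have hB2 : ¬ (2 : ℤ) ∣ Q p (z ^ 2) (y ^ 2) := by
      intro h2
      have hA2 : (2 : ℤ) ∣ z ^ 2 - y ^ 2 := by
        obtain ⟨k, hk⟩ := hz
        obtain ⟨l, hl⟩ := hy
        exact ⟨2 * (k ^ 2 + k) - 2 * (l ^ 2 + l), by rw [hk, hl]; ring⟩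
      have hu : IsUnit (2 : ℤ) := hAB.isUnit_of_dvd' h2 hA2
      norm_num [Int.isUnit_iff] at hu
    -- `gcd(Q_p(z,y), Q_p(z,-y)) = 1`
    have hcopQ : IsCoprime (Q p z y) (Q p z (-y)) := by
      rw [Int.isCoprime_iff_gcd_eq_one]
      by_contra hg
      obtain ⟨r, hr, hrg⟩ := Nat.exists_prime_and_dvd hg
      have hr1 : (r : ℤ) ∣ Q p z y := (Int.natCast_dvd_natCast.mpr hrg).trans (Int.gcd_dvd_left ..)
      have hr2 : (r : ℤ) ∣ Q p z (-y) :=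
        (Int.natCast_dvd_natCast.mpr hrg).trans (Int.gcd_dvd_right ..)
      have hr' : Prime (r : ℤ) := Nat.prime_iff_prime_int.mp hr
      have hr2ne : (r : ℤ) ≠ 2 := by
        intro h2
        rw [h2] at hr1
        exact hB2 (by rw [hBfac]; exact dvd_mul_of_dvd_left hr1 _)
      -- `r ∣ z^p − y^p` and `r ∣ z^p + y^p`
      have hd1 : (r : ℤ) ∣ z ^ p - y ^ p := by
        rw [← Q_mul_sub]; exact dvd_mul_of_dvd_left hr1 _
      have hd2 : (r : ℤ) ∣ z ^ p + y ^ p := by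
        have := Q_mul_sub p z (-y)
        rw [Odd.neg_pow hpodd, sub_neg_eq_add, sub_neg_eq_add] at this
        rw [← this]; exact dvd_mul_of_dvd_left hr2 _
      have hr2cop : IsCoprime (r : ℤ) 2 := by
        refine Int.isCoprime_two_right.mpr (hr.odd_of_ne_two ?_).natCast
        intro h2
        exact hr2ne (by exact_mod_cast h2)
      have hrz : (r : ℤ) ∣ z := by
        have : (r : ℤ) ∣ 2 * z ^ p := by
          have e : 2 * z ^ p = (z ^ p - y ^ p) + (z ^ p + y ^ p) := by ring
          rw [e]; exact dvd_add hd1 hd2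
        exact hr'.dvd_of_dvd_pow (hr2cop.dvd_of_dvd_mul_left this)
      have hry : (r : ℤ) ∣ y := by
        have : (r : ℤ) ∣ 2 * y ^ p := by
          have e : 2 * y ^ p = (z ^ p + y ^ p) - (z ^ p - y ^ p) := by ring
          rw [e]; exact dvd_sub hd2 hd1
        exact hr'.dvd_of_dvd_pow (hr2cop.dvd_of_dvd_mul_left this)
      exact hr'.not_unit (hzy.isUnit_of_dvd' hrz hry)
    have hprod : Q p z y * Q p z (-y) = c ^ 2 := by rw [← hBfac, hB]
    -- choose the sign with `z ≡ ±y (mod 4)`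
    have hzy4 : (4 : ℤ) ∣ z - y ∨ (4 : ℤ) ∣ z - -y := by
      obtain ⟨k, hk⟩ := hy
      obtain ⟨l, hl⟩ := hz
      subst hk; subst hl
      rcases Int.even_or_odd (l - k) with ⟨t, ht⟩ | ⟨t, ht⟩
      · exact Or.inl ⟨t, by linear_combination 2 * ht⟩
      · exact Or.inr ⟨l - t, by linear_combination (-2) * ht⟩
    rcases hzy4 with h4 | h4
    · have hzne : z ≠ y := fun h0 => hne2 (by rw [h0])
      obtain ⟨e, he⟩ := Int.sq_of_isCoprime hcopQ hprod
      have hQ : Q p z y = e ^ 2 := by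
        rcases he with he | he
        · exact he
        · nlinarith [sq_nonneg e, Q_pos hpodd hzne]
      exact Q_not_sq hy h4 hzne hzy hp hp2 e hQ
    · have hzne : z ≠ -y := fun h0 => hne2 (by rw [h0]; ring)
      obtain ⟨e, he⟩ := Int.sq_of_isCoprime hcopQ.symm (by rw [mul_comm]; exact hprod)
      have hQ : Q p z (-y) = e ^ 2 := by
        rcases he with he | he
        · exact he
        · nlinarith [sq_nonneg e, Q_pos hpodd hzne]
      exact Q_not_sq hy.neg h4 hzne hzy.neg_right hp hp2 e hQ
  · -- the gcd is `p`: `p ∣ x`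
    have hpx : (p : ℤ) ∣ x := by
      rw [Int.isCoprime_iff_gcd_eq_one] at hAB
      obtain ⟨r, hr, hrg⟩ := Nat.exists_prime_and_dvd hAB
      have hr1 : (r : ℤ) ∣ Q p (z ^ 2) (y ^ 2) :=
        (Int.natCast_dvd_natCast.mpr hrg).trans (Int.gcd_dvd_left ..)
      have hr2 : (r : ℤ) ∣ z ^ 2 - y ^ 2 := (Int.natCast_dvd_natCast.mpr hrg).trans (Int.gcd_dvd_right ..)
      have hr' : Prime (r : ℤ) := Nat.prime_iff_prime_int.mp hr
      have hrp : (r : ℤ) ∣ p := dvd_of_dvd_sub_of_dvd_Q hzy2 hne2 hr2 hr1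
      have hrp' : r = p := (Nat.prime_dvd_prime_iff_eq hr hp).mp (Int.natCast_dvd_natCast.mp hrp)
      rw [hrp'] at hr1
      have h1 : (p : ℤ) ∣ (x ^ p) ^ 2 := by rw [← hfac]; exact dvd_mul_of_dvd_left hr1 _
      exact hp'.dvd_of_dvd_pow (hp'.dvd_of_dvd_pow h1)
    have h2p : IsCoprime (2 : ℤ) p := by
      rw [Int.isCoprime_iff_gcd_eq_one]
      have : Nat.Coprime 2 p := Nat.coprime_two_left.mpr hpodd
      exact_mod_cast this
    exact h2p.mul_dvd hx2 hpx

/-- **Terjanian's theorem (1977): the first case of Fermat's Last Theorem for even exponents.**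
If `p` is an odd prime and `x^{2p} + y^{2p} = z^{2p}` in integers, then `2p` divides `x` or `y`.
(Ribenboim (4K) states it for non-zero `x, y, z`; for `x = 0` or `y = 0` the conclusion is trivial, and
the reduction to `gcd(x, y) = 1`, `x` even is the printed "we assume that gcd(x, y) = 1 ... we may
assume that `x` is even".) [cite: Terjanian1977] [cite: Ribenboim1999FLTAmateurs, Ch. VI (4K)] -/
theorem terjanian {p : ℕ} (hp : p.Prime) (hp2 : p ≠ 2) {x y z : ℤ}
    (h : x ^ (2 * p) + y ^ (2 * p) = z ^ (2 * p)) : 2 * (p : ℤ) ∣ x ∨ 2 * (p : ℤ) ∣ y := by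
  by_cases hx0 : x = 0
  · exact Or.inl (by simp [hx0])
  have h2p0 : 2 * p ≠ 0 := by have := hp.pos; omega
  obtain ⟨g, x', y', hg, hcop, hx, hy⟩ := Int.exists_gcd_one' (Int.gcd_pos_of_ne_zero_left y hx0)
  have hcop' : IsCoprime x' y' := Int.isCoprime_iff_gcd_eq_one.mpr hcop
  have hgz : (g : ℤ) ∣ z := by
    have h1 : (g : ℤ) ^ (2 * p) ∣ z ^ (2 * p) := by
      rw [← h, hx, hy, mul_pow, mul_pow]
      exact dvd_add (dvd_mul_left _ _) (dvd_mul_left _ _)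
    exact (Int.pow_dvd_pow_iff h2p0).mp h1
  obtain ⟨z', hz⟩ := hgz
  have hg0 : (g : ℤ) ≠ 0 := by exact_mod_cast hg.ne'
  have h' : x' ^ (2 * p) + y' ^ (2 * p) = z' ^ (2 * p) := by
    have e : (g : ℤ) ^ (2 * p) * (x' ^ (2 * p) + y' ^ (2 * p)) = (g : ℤ) ^ (2 * p) * z' ^ (2 * p) := by
      have h1 := h
      rw [hx, hy, hz, mul_pow, mul_pow, mul_pow] at h1
      linear_combination h1
    exact mul_left_cancel₀ (pow_ne_zero _ hg0) e
  rcases Int.even_or_odd x' with hxe | hxo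
  · left
    have h1 := two_mul_dvd_of_isCoprime hp hp2 hcop' (even_iff_two_dvd.mp hxe) h'
    rw [hx]
    exact dvd_mul_of_dvd_left h1 _
  · rcases Int.even_or_odd y' with hye | hyo
    · right
      have h'' : y' ^ (2 * p) + x' ^ (2 * p) = z' ^ (2 * p) := by linear_combination h'
      have h1 := two_mul_dvd_of_isCoprime hp hp2 hcop'.symm (even_iff_two_dvd.mp hye) h''
      rw [hy]
      exact dvd_mul_of_dvd_left h1 _
    · exact (not_both_odd h' hxo hyo).elim

/-- The same with the exponent written as `n` (`n` even, `n/2` an odd prime): `xⁿ + yⁿ = zⁿ` implies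
`n ∣ x` or `n ∣ y`. [cite: Ribenboim1999FLTAmateurs, Ch. VI (4K)] -/
theorem terjanian' {n : ℕ} (hn : (n / 2).Prime) (hn2 : n / 2 ≠ 2) (he : Even n) {x y z : ℤ}
    (h : x ^ n + y ^ n = z ^ n) : (n : ℤ) ∣ x ∨ (n : ℤ) ∣ y := by
  have e : n = 2 * (n / 2) := by obtain ⟨k, rfl⟩ := he; omega
  have h' : x ^ (2 * (n / 2)) + y ^ (2 * (n / 2)) = z ^ (2 * (n / 2)) := by rw [← e]; exact h
  have := terjanian hn hn2 h'
  have e' : (n : ℤ) = 2 * ((n / 2 : ℕ) : ℤ) := by exact_mod_cast e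
  rw [e']
  exact this

end Terjanian

end Literature.NumberTheory.DiophantineGeometry
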